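import Summits.CriticalPhenomena.CardyFormulaZ2.Theorems.CardySelfRefinementLagHandOffNoIdleAuxFourArm
import Summits.CriticalPhenomena.CardyFormulaZ2.Theorems.CardySelfRefinementLagHandOffNoIdleAuxAlternation
import Literature.Probability.LatticeModels.DobrushinDiscretisation
import HarnessLib

/-!
# No idling of the limit interface, part 5: the four-arm bound for the alternation event at
a bulk point, along a discretisation family

Helper file for the registered stub `stub_limitCurveRegularity_noIdle` of line
`hitting-tournament` of crux `LagHandOff` (stmt-CriticalPhenomena-10268).  For a
`ℤ²`-discretisation family `E` of a Dobrushin domain `D` and scales `1000ε ≤ R`, for all small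
meshes `δ` and every point `g` at distance `≥ 2R` from `∂D`, the probability that the interface
class `bondInterfaceIn D (E δ) ω` has a representative alternating around `g` with thresholds
`(2ε, R)` is at most `2K(600ε/R)^{1+η}`, where `K, η` are the constants of a multi-scale
four-arm bound `π₄(m, n) ≤ K (m/n)^{1+η}` (Garban; the tree's `QuadCrossing.fourArm_bound`,
taken here as a hypothesis to keep the import cone light).

Proof.  On lattice configurations (`ae_subset_edgeSet`): an alternating representative makes
the exploration polygon alternate (`alternates_of_mk_eq`, `alternates_reverse` for the
re-orientation `orientCurve`), hence traverse the shell `D(g; 2ε, R)` three separate times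
(`hasTraversals_three_of_alternates`); all sites of the discrete boundary are within `2δ` of
`∂D` (`exists_frontier_near_of_mem_zdBoundary'`, the general-data form of the tree's lemma),
so both discrete arcs are at distance `≥ R` from `g`, and the dictionary
`fourArm_of_hasTraversals` puts `ω` or `dualConfig ω` in Garban's event around the nearest
site to `g` with radii `m₁ = ⌈32ε/δ⌉ + 4`, `n₁ = ⌊R/(8δ)⌋ - 2`; translation invariance
(`real_fourArmTwoClustersAt`), self-duality (`bondPercolation_map_dualConfig_holds`) and the
four-arm bound conclude.

References: C. Garban, App. B of O. Schramm, S. Smirnov, Ann. Probab. 39 (2011), Lemma B.1;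
M. Aizenman, A. Burchard, Duke Math. J. 99 (1999), App. A; S. Smirnov, C. R. Acad. Sci. 333
(2001) §2.
-/

noncomputable section

open MeasureTheory Filter Set Topology Metric
open scoped unitInterval ENNReal Pointwise
open Literature.Probability.Percolation Literature.Probability.LatticeModels
open Literature.Probability.RandomPlanarGeometry

namespace Summit.CriticalPhenomena.CardyFormulaZ2.Cruxes.LagHandOff.HittingTournament

/-! ### Discrete boundary sites are close to the boundary curve (general data) -/

-- adapted from `Literature.Probability.Percolation.exists_frontier_near_of_mem_zdBoundary`
-- (InterfaceTraversalBound.lean, Part II), dropping the trace clause and the canonical data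
/-- **Every site of the discrete boundary `∂Ω_δ` is within `2δ` of `∂Ω`**, for arbitrary
discrete Dobrushin data on a Jordan domain: along a lattice edge at the site which is not an
edge of `Ω_δ` (it leaves `Ω̄`, or ends at a mesh point off `Ω`), or inside a non-inner face at
the site (which contains a point off `Ω`, since otherwise all its sides would be edges of
`Ω_δ`). [cite: Smirnov2001, §2] -/
theorem exists_frontier_near_of_mem_zdBoundary' (Dm : DobrushinDomain) {D' : DiscreteDobrushin}
    (hΩ : D'.Ω = Dm.carrier) (hδ : 0 < D'.δ) {u : Site 2} (hu : u ∈ D'.zdBoundary) :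
    ∃ z ∈ frontier Dm.carrier, dist z (meshPoint D'.δ u) ≤ 2 * D'.δ := by
  have huΩ : meshPoint D'.δ u ∈ D'.Ω :=
    meshDomain_subset_meshVertices _ _ (D'.zdBoundary_subset_meshDomain hu)
  have hopen : IsOpen D'.Ω := by rw [hΩ]; exact Dm.isOpen
  -- frontier point on a segment from `δu` to a point off `Ω`
  have cross : ∀ {q : ℂ}, q ∉ D'.Ω →
      ∃ z ∈ segment ℝ (meshPoint D'.δ u) q, z ∈ frontier D'.Ω := by
    intro q hq
    have h1 : (segment ℝ (meshPoint D'.δ u) q ∩ Dm.carrier).Nonempty :=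
      ⟨_, left_mem_segment _ _ _, by rw [← hΩ]; exact huΩ⟩
    have h2 : (segment ℝ (meshPoint D'.δ u) q ∩ Dm.carrierᶜ).Nonempty :=
      ⟨q, right_mem_segment _ _ _, by rw [← hΩ]; exact hq⟩
    obtain ⟨z, hz1, hz2⟩ := Dm.inter_frontier_nonempty_of_isPreconnected
      (convex_segment (meshPoint D'.δ u) q).isPreconnected h1 h2
    exact ⟨z, hz1, by rw [hΩ]; exact hz2⟩
  suffices h : ∃ z ∈ frontier D'.Ω, dist z (meshPoint D'.δ u) ≤ 2 * D'.δ by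
    rw [hΩ] at h; exact h
  rcases D'.mem_zdBoundary_iff.1 hu with hu' | ⟨y, hadj, -, g, hg, hug, hyg⟩
  · -- `u ∈ meshBoundary`: a lattice neighbour `y` not `Ω_δ`-adjacent
    obtain ⟨huD, y, hzd, hnadj⟩ := mem_meshBoundary_iff.1 hu'
    have hdist : dist (meshPoint D'.δ y) (meshPoint D'.δ u) = D'.δ := by
      rw [dist_comm, dist_meshPoint_of_adj hzd, abs_of_pos hδ]
    by_cases hseg : segment ℝ (meshPoint D'.δ u) (meshPoint D'.δ y) ⊆ closure D'.Ω
    · -- then `δy ∉ Ω` (else `y ∈ Ω_δ`), so `δy ∈ ∂Ω`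
      have hyΩ : meshPoint D'.δ y ∉ D'.Ω := by
        intro hyΩ
        apply hnadj
        rw [discreteDomainGraph_adj_iff]
        have hmesh : (meshGraph D'.Ω D'.δ).Adj u y := meshGraph_adj_iff.2 ⟨hzd, hseg⟩
        exact ⟨hmesh, huD, mem_meshDomain_of_meshGraph_adj huD hyΩ hmesh⟩
      refine ⟨meshPoint D'.δ y, ⟨hseg (right_mem_segment _ _ _), ?_⟩, by linarith⟩
      rw [hopen.interior_eq]; exact hyΩ
    · obtain ⟨q, hq, hqΩ⟩ := not_subset.1 hseg
      obtain ⟨z, hz, hzfr⟩ := cross (fun h => hqΩ (subset_closure h))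
      have hsub : segment ℝ (meshPoint D'.δ u) z ⊆ segment ℝ (meshPoint D'.δ u) (meshPoint D'.δ y) :=
        (convex_segment _ _).segment_subset (left_mem_segment _ _ _)
          ((convex_segment _ _).segment_subset (left_mem_segment _ _ _) hq hz)
      refine ⟨z, hzfr, ?_⟩
      have hzball : z ∈ closedBall (meshPoint D'.δ u) D'.δ :=
        (convex_closedBall _ _).segment_subset
          (mem_closedBall.2 (by rw [dist_self]; exact hδ.le)) (mem_closedBall.2 hdist.le)
          (hsub (right_mem_segment _ _ _))
      rw [mem_closedBall] at hzball; linarith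
  · -- `u` is a corner of a non-inner face `g`: some point of `g` is off `Ω`
    have huD : u ∈ meshDomain D'.Ω D'.δ := (discreteDomainGraph_adj_iff.1 hadj).2.1
    have hsq : ∃ q ∈ D'.δ • closedSq g, q ∉ D'.Ω := by
      by_contra hall
      push Not at hall
      apply hg
      -- all corners are mesh vertices, all sides are mesh edges: `g` is inner
      have hvert : ∀ v, IsCorner v g → meshPoint D'.δ v ∈ D'.Ω := fun v hv =>
        hall _ (by rw [meshPoint_eq_smul]; exact Set.smul_mem_smul_set (toComplex_mem_closedSq hv))
      have hmesh : ∀ v w, IsCorner v g → IsCorner w g → (zdGraph 2).Adj v w →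
          (meshGraph D'.Ω D'.δ).Adj v w := by
        intro v w hv hw hvw
        refine meshGraph_adj_iff.2 ⟨hvw, fun p hp => subset_closure (hall p ?_)⟩
        rw [meshPoint_eq_smul, meshPoint_eq_smul, ← smul_segment_eq] at hp
        obtain ⟨p', hp', rfl⟩ := hp
        exact Set.smul_mem_smul_set ((convex_closedSq g).segment_subset (toComplex_mem_closedSq hv)
          (toComplex_mem_closedSq hw) hp')
      have hdom : ∀ v, IsCorner v g → v ∈ meshDomain D'.Ω D'.δ := by
        intro v hv
        rcases IsCorner.exists_adj_chain hug hv with rfl | h | ⟨c, hc, h1, h2⟩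
        · exact huD
        · exact mem_meshDomain_of_meshGraph_adj huD (hvert v hv) (hmesh _ _ hug hv h)
        · exact mem_meshDomain_of_meshGraph_adj
            (mem_meshDomain_of_meshGraph_adj huD (hvert c hc) (hmesh _ _ hug hc h1))
            (hvert v hv) (hmesh _ _ hc hv h2)
      intro v w hv hw hvw
      exact discreteDomainGraph_adj_iff.2 ⟨hmesh v w hv hw hvw, hdom v hv, hdom w hw⟩
    obtain ⟨q, hq, hqΩ⟩ := hsq
    obtain ⟨z, hz, hzfr⟩ := cross hqΩ
    have husq : meshPoint D'.δ u ∈ D'.δ • closedSq g := by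
      rw [meshPoint_eq_smul]; exact Set.smul_mem_smul_set (toComplex_mem_closedSq hug)
    have hconv : Convex ℝ (D'.δ • closedSq g) := (convex_closedSq g).smul D'.δ
    have hsub : segment ℝ (meshPoint D'.δ u) z ⊆ D'.δ • closedSq g :=
      hconv.segment_subset husq (hconv.segment_subset husq hq hz)
    refine ⟨z, hzfr, ?_⟩
    have := closedSq_subset_closedBall hug ((Set.mem_smul_set_iff_inv_smul_mem₀ hδ.ne' _ _).1
      (hsub (right_mem_segment _ _ _)))
    rw [mem_closedBall, ← mul_le_mul_iff_right₀ hδ, ← abs_of_pos hδ, ← Real.norm_eq_abs,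
      ← dist_smul₀, Real.norm_eq_abs, abs_of_pos hδ, smul_inv_smul₀ hδ.ne',
      ← meshPoint_eq_smul] at this
    linarith

/-- Sites of the two discrete arcs of admissible data on `D` are at distance `≥ R` from a point
at distance `≥ 2R` from `∂D`, once `2δ ≤ R`. -/
theorem le_dist_meshPoint_of_mem_zdBoundary (Dm : DobrushinDomain) {D' : DiscreteDobrushin}
    (hΩ : D'.Ω = Dm.carrier) (hδ : 0 < D'.δ) {g : ℂ} {R : ℝ}
    (hg : 2 * R ≤ infDist g (frontier Dm.carrier)) (hδR : 2 * D'.δ ≤ R) {u : Site 2}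
    (hu : u ∈ D'.zdBoundary) : R ≤ dist (meshPoint D'.δ u) g := by
  obtain ⟨z, hz, hzu⟩ := exists_frontier_near_of_mem_zdBoundary' Dm hΩ hδ hu
  have h1 : infDist g (frontier Dm.carrier) ≤ dist g z := infDist_le_dist_of_mem hz
  linarith [dist_triangle g (meshPoint D'.δ u) z, dist_comm z (meshPoint D'.δ u),
    dist_comm g (meshPoint D'.δ u)]

/-! ### The four-arm bound for the alternation event at a bulk point -/

/-- **The alternation event at a bulk point has four-arm probability.** Let `E` be a
`ℤ²`-discretisation family of the Dobrushin domain `D`, let `K (m/n)^{1+η}` bound the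
probabilities of Garban's four-arm events `fourArmTwoClusters m n` (`1 ≤ m ≤ n`), and let
`0 < ε`, `1000ε ≤ R`. Then for all small meshes `δ` and every point `g` at distance `≥ 2R`
from `∂D`, the probability (critical bond percolation) that the interface class
`bondInterfaceIn D (E δ) ω` has a representative alternating around `g` with thresholds
`(2ε, R)` is at most `2K(600ε/R)^{1+η}`. See the module docstring for the proof.
[cite: SchrammSmirnov2011, Appendix B (Garban), Lemma B.1]
[cite: AizenmanBurchardDuke1999, Appendix A] -/
theorem measure_exists_alternates_le (D : DobrushinDomain) {E : ℝ → DiscreteDobrushin}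
    (hE : ZdDiscretisationFamily D E) {K η : ℝ} (hK : 0 ≤ K) (hη : 0 ≤ η)
    (hbound : ∀ m n : ℕ, 1 ≤ m → m ≤ n →
      (bondPercolation (zdGraph 2) half).real (fourArmTwoClusters m n) ≤
        K * ((m : ℝ) / n) ^ (1 + η))
    {ε R : ℝ} (hε : 0 < ε) (hεR : 1000 * ε ≤ R) :
    ∀ᶠ δ in 𝓝[>] (0 : ℝ), ∀ g : ℂ, 2 * R ≤ infDist g (frontier D.carrier) →
      bondPercolation (zdGraph 2) half
          {ω | ∃ c : Curve ℂ, CurveClass.mk c = bondInterfaceIn D (E δ) ω ∧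
            ∃ t₁ t₂ t₃ : I, t₁ < t₂ ∧ t₂ < t₃ ∧ dist (c t₁) g < 2 * ε ∧ R < dist (c t₂) g ∧
              dist (c t₃) g < 2 * ε ∧ R < dist (c 0) g ∧ R < dist (c 1) g} ≤
        ENNReal.ofReal (2 * K * (600 * ε / R) ^ (1 + η)) := by
  have hR : 0 < R := by linarith
  have h1 := hE.eventually_isZdAdmissible
  have h2 : ∀ᶠ δ in 𝓝[>] (0 : ℝ), δ ≤ ε := mem_nhdsWithin_of_mem_nhds (Iic_mem_nhds hε)
  have h3 : ∀ᶠ δ in 𝓝[>] (0 : ℝ), δ ∈ Ioi (0 : ℝ) := self_mem_nhdsWithin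
  filter_upwards [h1, h2, h3] with δ hadm hδε hδpos g hg
  have hδ : 0 < δ := hδpos
  set P := bondPercolation (zdGraph 2) half with hP
  have hδeq : (E δ).δ = δ := hE.δ_eq δ
  have hΩ : (E δ).Ω = D.carrier := hE.Ω_eq δ
  have hδ' : 0 < (E δ).δ := by rw [hδeq]; exact hδ
  -- the radii
  set m₁ : ℕ := ⌈32 * ε / δ⌉₊ + 4 with hm₁def
  set n₁ : ℕ := ⌊R / (8 * δ)⌋₊ - 2 with hn₁def
  have hceil1 : 32 * ε / δ ≤ (⌈32 * ε / δ⌉₊ : ℝ) := Nat.le_ceil _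
  have hceil2 : (⌈32 * ε / δ⌉₊ : ℝ) < 32 * ε / δ + 1 := Nat.ceil_lt_add_one (by positivity)
  have hm₁R : (m₁ : ℝ) = (⌈32 * ε / δ⌉₊ : ℝ) + 4 := by rw [hm₁def]; push_cast; ring
  have hm₁ge : 32 * ε + 4 * δ ≤ (m₁ : ℝ) * δ := by
    rw [hm₁R, add_mul]
    have : 32 * ε ≤ (⌈32 * ε / δ⌉₊ : ℝ) * δ := by
      have := mul_le_mul_of_nonneg_right hceil1 hδ.le
      rwa [div_mul_cancel₀ _ hδ.ne'] at this
    linarith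
  have hm₁le : (m₁ : ℝ) * δ ≤ 32 * ε + 5 * δ := by
    rw [hm₁R, add_mul]
    have : (⌈32 * ε / δ⌉₊ : ℝ) * δ ≤ 32 * ε + δ := by
      have := mul_le_mul_of_nonneg_right hceil2.le hδ.le
      rwa [add_mul, div_mul_cancel₀ _ hδ.ne', one_mul] at this
    linarith
  have hx : (2 : ℝ) ≤ R / (8 * δ) := by
    rw [le_div_iff₀ (by positivity)]; nlinarith
  have hfloor : 2 ≤ ⌊R / (8 * δ)⌋₊ := Nat.le_floor (by exact_mod_cast hx)
  have hfl1 : (⌊R / (8 * δ)⌋₊ : ℝ) ≤ R / (8 * δ) := Nat.floor_le (by positivity)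
  have hfl2 : R / (8 * δ) < (⌊R / (8 * δ)⌋₊ : ℝ) + 1 := Nat.lt_floor_add_one _
  have hn₁R : (n₁ : ℝ) = (⌊R / (8 * δ)⌋₊ : ℝ) - 2 := by
    rw [hn₁def, Nat.cast_sub hfloor]; norm_num
  have hn₁le : 8 * (n₁ : ℝ) * δ + 8 * δ ≤ R - 8 * δ := by
    rw [hn₁R]
    have : (⌊R / (8 * δ)⌋₊ : ℝ) * δ ≤ R / 8 := by
      have := mul_le_mul_of_nonneg_right hfl1 hδ.le
      rwa [show R / (8 * δ) * δ = R / 8 by field_simp] at this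
    nlinarith
  have hn₁ge : R / 8 - 3 * δ ≤ (n₁ : ℝ) * δ := by
    rw [hn₁R]
    have : R / 8 ≤ ((⌊R / (8 * δ)⌋₊ : ℝ) + 1) * δ := by
      have := mul_le_mul_of_nonneg_right hfl2.le hδ.le
      rwa [show R / (8 * δ) * δ = R / 8 by field_simp] at this
    nlinarith
  have h1m : 1 ≤ m₁ := by rw [hm₁def]; omega
  have hmnR : (m₁ : ℝ) ≤ n₁ := by
    have h1 : (m₁ : ℝ) * δ ≤ (n₁ : ℝ) * δ := by linarith
    exact le_of_mul_le_mul_right h1 hδ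
  have hmn : m₁ ≤ n₁ := by exact_mod_cast hmnR
  have hn₁pos : (0 : ℝ) < n₁ := by
    have h1 : (0 : ℝ) < (n₁ : ℝ) * δ := by nlinarith
    by_contra h
    push Not at h
    have : (n₁ : ℝ) * δ ≤ 0 := mul_nonpos_of_nonpos_of_nonneg h hδ.le
    linarith
  have hratio : (m₁ : ℝ) / n₁ ≤ 600 * ε / R := by
    rw [div_le_div_iff₀ hn₁pos hR]
    have ha : (m₁ : ℝ) * δ ≤ 37 * ε := by linarith
    have hb : R / 16 ≤ (n₁ : ℝ) * δ := by linarith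
    have h1 : (m₁ : ℝ) * R * δ ≤ 600 * ε * n₁ * δ := by nlinarith
    have h2 : ((m₁ : ℝ) * R) * δ ≤ (600 * ε * n₁) * δ := by linarith
    exact le_of_mul_le_mul_right h2 hδ
  have hratio0 : (0 : ℝ) ≤ (m₁ : ℝ) / n₁ := by positivity
  -- the centre and the event
  set c₀ : Site 2 := nearestSite δ g with hc₀
  have hc₀g : dist (meshPoint (E δ).δ c₀) g ≤ (E δ).δ := by
    rw [hδeq]; exact dist_meshPoint_nearestSite_le hδ g
  set F : Set (BondConfig (Site 2)) := fourArmTwoClustersAt c₀ m₁ n₁ with hF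
  have hfar : ∀ v ∈ (E δ).zdBoundary, R ≤ dist (meshPoint (E δ).δ v) g := fun v hv =>
    le_dist_meshPoint_of_mem_zdBoundary D hΩ hδ' hg (by rw [hδeq]; linarith) hv
  set A : Set (BondConfig (Site 2)) :=
    {ω | ∃ c : Curve ℂ, CurveClass.mk c = bondInterfaceIn D (E δ) ω ∧
      ∃ t₁ t₂ t₃ : I, t₁ < t₂ ∧ t₂ < t₃ ∧ dist (c t₁) g < 2 * ε ∧ R < dist (c t₂) g ∧
        dist (c t₃) g < 2 * ε ∧ R < dist (c 0) g ∧ R < dist (c 1) g} with hA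
  set good : Set (BondConfig (Site 2)) := {ω | ω ⊆ (zdGraph 2).edgeSet} with hgooddef
  have hincl : A ∩ good ⊆ F ∪ dualConfig ⁻¹' F := by
    rintro ω ⟨⟨c, hc, halt⟩, hωE⟩
    have hωE' : ω ⊆ (zdGraph 2).edgeSet := hωE
    have hexp := isMedialExploration_medialExploration_holds (E δ) hadm ω
    obtain ⟨a, l, hal⟩ := List.exists_cons_of_ne_nil hexp.ne_nil
    rw [hal] at hexp
    have hcurve : medialExplorationCurve (E δ) ω =
        polyline ((a :: l).map (medialPoint (E δ).δ)) := by
      rw [medialExplorationCurve, hal]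
    have halt1 := alternates_of_mk_eq halt (hc.trans (bondInterfaceIn_apply D (E δ) ω))
    have halt2 : ∃ t₁ t₂ t₃ : I, t₁ < t₂ ∧ t₂ < t₃ ∧
        dist ((⟨polyline ((a :: l).map (medialPoint (E δ).δ))⟩ : Curve ℂ) t₁) g < 2 * ε ∧
        R < dist ((⟨polyline ((a :: l).map (medialPoint (E δ).δ))⟩ : Curve ℂ) t₂) g ∧
        dist ((⟨polyline ((a :: l).map (medialPoint (E δ).δ))⟩ : Curve ℂ) t₃) g < 2 * ε ∧
        R < dist ((⟨polyline ((a :: l).map (medialPoint (E δ).δ))⟩ : Curve ℂ) 0) g ∧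
        R < dist ((⟨polyline ((a :: l).map (medialPoint (E δ).δ))⟩ : Curve ℂ) 1) g := by
      rcases Interface.orientCurve_eq_or D (medialExplorationCurve (E δ) ω) with h | h
      · rw [h, hcurve] at halt1; exact halt1
      · rw [h] at halt1
        have := alternates_reverse halt1
        rw [Interface.reverseCurve_reverseCurve, hcurve] at this
        exact this
    have htr := hasTraversals_three_of_alternates halt2
    have key := fourArm_of_hasTraversals hexp hδ' hωE' (x := g) (ρ := 2 * ε) (R := R)
      (by rw [hδeq]; linarith) (by linarith)
      (fun v hv => hfar v ((E δ).zdArcA_subset_zdBoundary hv))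
      (fun v hv => hfar v ((E δ).zdArcB_subset_zdBoundary hv)) hc₀g h1m hmn
      (by rw [hδeq]; linarith) (by rw [hδeq]; linarith) htr
    rcases key with h | h
    · left
      show ω ∈ fourArmTwoClustersAt c₀ m₁ n₁
      rw [fourArmTwoClustersAt_eq_preimage]; exact h
    · right
      show dualConfig ω ∈ fourArmTwoClustersAt c₀ m₁ n₁
      rw [fourArmTwoClustersAt_eq_preimage]; exact h
  -- the measure bound
  have hgood : P goodᶜ = 0 := by
    have := ae_subset_edgeSet (zdGraph 2) half
    rw [ae_iff] at this
    exact this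
  have hPF : P F ≤ ENNReal.ofReal (K * (600 * ε / R) ^ (1 + η)) := by
    rw [← ENNReal.ofReal_toReal (measure_ne_top P F)]
    refine ENNReal.ofReal_le_ofReal ?_
    rw [← measureReal_def, hF, hP, real_fourArmTwoClustersAt half c₀ m₁ n₁]
    refine (hbound m₁ n₁ h1m hmn).trans ?_
    exact mul_le_mul_of_nonneg_left (Real.rpow_le_rpow hratio0 hratio (by linarith)) hK
  have hPdual : P (dualConfig ⁻¹' F) ≤ P F := by
    calc P (dualConfig ⁻¹' F) ≤ P.map dualConfig F :=
          Measure.le_map_apply measurable_dualConfig.aemeasurable _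
      _ = P F := by
          rw [hP, bondPercolation_map_dualConfig_holds half,
            show unitInterval.symm half = half from Subtype.ext (by simp [half]; norm_num)]
  have hKX : 0 ≤ K * (600 * ε / R) ^ (1 + η) := by positivity
  calc P A ≤ P (A ∩ good ∪ goodᶜ) := by
        refine measure_mono fun ω hω => ?_
        by_cases h : ω ∈ good
        · exact Or.inl ⟨hω, h⟩
        · exact Or.inr h
    _ ≤ P (A ∩ good) + P goodᶜ := measure_union_le _ _
    _ = P (A ∩ good) := by rw [hgood, add_zero]
    _ ≤ P (F ∪ dualConfig ⁻¹' F) := measure_mono hincl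
    _ ≤ P F + P (dualConfig ⁻¹' F) := measure_union_le _ _
    _ ≤ ENNReal.ofReal (K * (600 * ε / R) ^ (1 + η)) +
          ENNReal.ofReal (K * (600 * ε / R) ^ (1 + η)) := add_le_add hPF (hPdual.trans hPF)
    _ = ENNReal.ofReal (2 * K * (600 * ε / R) ^ (1 + η)) := by
        rw [← ENNReal.ofReal_add hKX hKX]; ring_nf

/-- **Registered sub-stub `stub_noIdle_grid`** (line `hitting-tournament`, stub
`stub_limitCurveRegularity_noIdle`, helper 5): `measure_exists_alternates_le` with all arguments
explicit. [cite: SchrammSmirnov2011, Appendix B (Garban), Lemma B.1] -/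
theorem stub_noIdle_grid : ∀ (D : DobrushinDomain) (E : ℝ → DiscreteDobrushin), ZdDiscretisationFamily D E → ∀ (K η : ℝ), 0 ≤ K → 0 ≤ η → (∀ m n : ℕ, 1 ≤ m → m ≤ n → (bondPercolation (zdGraph 2) half).real (fourArmTwoClusters m n) ≤ K * ((m : ℝ) / n) ^ (1 + η)) → ∀ (ε R : ℝ), 0 < ε → 1000 * ε ≤ R → ∀ᶠ δ in nhdsWithin (0 : ℝ) (Set.Ioi 0), ∀ g : ℂ, 2 * R ≤ Metric.infDist g (frontier D.carrier) → bondPercolation (zdGraph 2) half {ω | ∃ c : Curve ℂ, CurveClass.mk c = bondInterfaceIn D (E δ) ω ∧ ∃ t₁ t₂ t₃ : unitInterval, t₁ < t₂ ∧ t₂ < t₃ ∧ dist (c t₁) g < 2 * ε ∧ R < dist (c t₂) g ∧ dist (c t₃) g < 2 * ε ∧ R < dist (c 0) g ∧ R < dist (c 1) g} ≤ ENNReal.ofReal (2 * K * (600 * ε / R) ^ (1 + η)) :=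
  fun D _ hE _ _ hK hη hbound _ _ hε hεR => measure_exists_alternates_le D hE hK hη hbound hε hεR

end Summit.CriticalPhenomena.CardyFormulaZ2.Cruxes.LagHandOff.HittingTournament

end
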